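import Summits.CriticalPhenomena.CardyFormulaZ2.Theses.CardySelfRefinement
import Literature.Probability.Percolation.QuadCrossingContinuityOfLemma51
import HarnessLib

/-!
# Compactness of the full-plane quad laws: stub `stub_quadCompactness` of line
# `crosscut-dictionary` for crux `LagHandOff` (stmt-CriticalPhenomena-10268)

Schramm–Smirnov 2011, Cor. 1.6, in Mathlib form for critical bond percolation on `ℤ²`: along every
sequence of positive meshes `δₙ → 0` some subsequence of the full-plane quad-crossing laws
`μ_δ = z2QuadLaw univ δ` (finite measures on `ℋ_ℂ = QuadConfig univ`) converges weakly, and the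
limit is a subsequential scaling limit (`μ ∈ subseqQuadLimits univ`).

Proof: `ℋ_ℂ` is compact, metrizable and Hausdorff (`QuadConfig.compactSpace`,
`SchrammSmirnov2011_thm_1_4_holds`), hence separable; the laws `μ_δ`, `δ > 0`, are probability
measures (`isProbabilityMeasure_z2QuadLaw_of_pos`); Mathlib's `ProbabilityMeasure ℋ_ℂ` is then a
compact metrizable space (Riesz–Markov–Kakutani / Lévy–Prokhorov), so `isCompact_univ.tendsto_subseq`
extracts a convergent subsequence, transported to `FiniteMeasure` by
`ProbabilityMeasure.tendsto_nhds_iff_toFiniteMeasure_tendsto_nhds`; membership in `Λ` is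
`isSubseqQuadLimit_iff`.  This makes "ONE subsequence `φ` for all `(D, E)`" free in the line's
composition and closes the vacuity channel `Λ = ∅` of `Cruxes/LagHandOff/Disproof.lean`.
-/

noncomputable section

open MeasureTheory Filter Set Topology
open scoped BoundedContinuousFunction
open Literature.Probability.Percolation Literature.Probability.LatticeModels
open Literature.Probability.RandomPlanarGeometry Literature.Probability.Percolation.QuadCrossing
open Summit.CriticalPhenomena.CardyFormulaZ2.Theses.CardySelfRefinement

namespace Summit.CriticalPhenomena.CardyFormulaZ2.Cruxes.LagHandOff.CrosscutDictionary

-- adapted from Lines/hitting-tournament.lean (planner-cruxplan skeleton, line hitting-tournament),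
-- theorem `exists_quadLimit_subseq`
/-- **Schramm–Smirnov Cor. 1.6 along a given mesh sequence.** Along every sequence of positive
meshes `δₙ → 0` some subsequence of the full-plane laws `μ_{δₙ} = z2QuadLaw univ δₙ` converges
weakly, and the limit is a subsequential scaling limit (`ℋ_ℂ` is compact metrizable Hausdorff —
`QuadConfig.compactSpace`, `SchrammSmirnov2011_thm_1_4_holds` — so its probability laws form a
compact metrizable space; `isProbabilityMeasure_z2QuadLaw_of_pos` makes every `μ_δ`, `δ > 0`, a
probability law). -/
theorem exists_mem_subseqQuadLimits_tendsto_subseq (δs : ℕ → ℝ) (hpos : ∀ n, 0 < δs n)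
    (hlim : Tendsto δs atTop (𝓝 0)) :
    ∃ φ : ℕ → ℕ, StrictMono φ ∧ ∃ μ : FiniteMeasure (QuadConfig (univ : Set ℂ)),
      μ ∈ subseqQuadLimits (univ : Set ℂ) ∧
        Tendsto (fun n => z2QuadLaw univ (δs (φ n))) atTop (𝓝 μ) := by
  haveI : T2Space (QuadConfig (univ : Set ℂ)) :=
    (SchrammSmirnov2011_thm_1_4_holds univ isOpen_univ univ_nonempty).1.2.2
  haveI : CompactSpace (QuadConfig (univ : Set ℂ)) := QuadConfig.compactSpace
  haveI : TopologicalSpace.MetrizableSpace (QuadConfig (univ : Set ℂ)) :=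
    (SchrammSmirnov2011_thm_1_4_holds univ isOpen_univ univ_nonempty).1.2.1
  haveI : TopologicalSpace.SeparableSpace (QuadConfig (univ : Set ℂ)) := by
    letI := TopologicalSpace.metrizableSpaceMetric (QuadConfig (univ : Set ℂ))
    infer_instance
  haveI hprob : ∀ n, IsProbabilityMeasure
      (z2QuadLaw univ (δs n) : Measure (QuadConfig (univ : Set ℂ))) :=
    fun n => isProbabilityMeasure_z2QuadLaw_of_pos isOpen_univ (hpos n)
  let π : ℕ → ProbabilityMeasure (QuadConfig (univ : Set ℂ)) := fun n =>
    ⟨(z2QuadLaw univ (δs n) : Measure (QuadConfig (univ : Set ℂ))), hprob n⟩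
  have hπF : ∀ n, (π n).toFiniteMeasure = z2QuadLaw univ (δs n) := fun n => rfl
  obtain ⟨πlim, -, φ, hφ, hlimπ⟩ := isCompact_univ.tendsto_subseq (x := π) fun n => mem_univ _
  have hconv : Tendsto (fun k => z2QuadLaw univ (δs (φ k))) atTop (𝓝 πlim.toFiniteMeasure) := by
    have := (ProbabilityMeasure.tendsto_nhds_iff_toFiniteMeasure_tendsto_nhds _).1 hlimπ
    simpa only [Function.comp_def, hπF] using this
  refine ⟨φ, hφ, πlim.toFiniteMeasure, ?_, hconv⟩
  exact (isSubseqQuadLimit_iff univ _).2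
    ⟨fun k => δs (φ k), fun k => hpos _, hlim.comp hφ.tendsto_atTop, hconv⟩

/-- **STUB 1 of line `crosscut-dictionary` (Schramm–Smirnov Cor. 1.6 in Mathlib form).** Every
positive mesh sequence tending to `0` has a subsequence along which the full-plane quad-crossing
laws `μ_δ = z2QuadLaw univ δ` of critical bond percolation on `δℤ²` converge weakly in
`FiniteMeasure ℋ_ℂ`. -/
theorem stub_quadCompactness : ∀ δs : ℕ → ℝ, (∀ n, 0 < δs n) → Tendsto δs atTop (𝓝 0) → ∃ φ : ℕ → ℕ, StrictMono φ ∧ ∃ μ : FiniteMeasure (QuadConfig (Set.univ : Set ℂ)), Tendsto (fun n => z2QuadLaw (Set.univ : Set ℂ) (δs (φ n))) atTop (𝓝 μ) := by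
  intro δs hpos hlim
  obtain ⟨φ, hφ, μ, -, hconv⟩ := exists_mem_subseqQuadLimits_tendsto_subseq δs hpos hlim
  exact ⟨φ, hφ, μ, hconv⟩

end Summit.CriticalPhenomena.CardyFormulaZ2.Cruxes.LagHandOff.CrosscutDictionary

end
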